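import Literature.NumberTheory.EllipticCurves.DivisionFieldReducibleBorelCyclotomic
import HarnessLib

/-!
# The Borel field `K(χ₁, χ₂)` of a line of a reducible `E[p]` CONTAINS `μ_p` (`χ₁χ₂ = ω`, Weil pairing); at `p = 3` its
# Galois group is killed by `2` (theorems only; no definition, no named fact)

Topic `NumberTheory/EllipticCurves` (namespace `WeierstrassCurve`, as in the siblings `DivisionFieldReducibleBorelKernel.lean`,
`DivisionFieldReducibleBorelCyclotomic.lean`).  Written by the prover seat `bsd-potss-rkm` g36 (cell `bsd-potss`, item
stmt-BirchSwinnertonDyer-19196 `ReducibleKatoMember`, crux M of K9 / K8-t′; `--supports`, closes nothing).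

WHY.  The `μ`-input of Coates–Sujatha's (A) / Kato's member bound on a reducible row is `μ = 0` for the cyclotomic tower of
the Borel field `L = K(χ₁, χ₂)`; the reflection descent of `IwasawaTheory/ClassicalMuVanishesReflectionDescent.lean` needs
`ζ_p ∈ L` (Lang's Thm. 2.1 is about CM fields containing `μ_p`) and, at `p = 3`, that `Gal(L/ℚ)` is an elementary abelian
`2`-group (so that `L` is biquadratic over `ℚ` at most).  Both are the sentence «`ρ̄ = (χ₁ * ; 0 χ₂)` with `χ₁χ₂ = det ρ̄ = ω`»
(Serre 1972 §4): (i) for `σ ∈ borelKernel C` (trivial on `C` and on `E[p]/C`) and a generator `g` of `C`,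
`σ·e_p(g, y) = e_p(σg, σy) = e_p(g, y + c) = e_p(g, y)` (`c ∈ C = ℤg`, `e_p` alternating), and `e_p(g, y)` is a PRIMITIVE `p`-th root
for `y ∉ C` (non-degeneracy), fixed by `borelKernel C = Gal(K̄/L)`, hence in `L`; (ii) at `p = 3` every `σ ∈ Γ_K` acts on the line
`C` and on `E[3]/C` through `𝔽₃^× = {±1}`, so `σ²` acts trivially on both: `σ² ∈ borelKernel C`, i.e. `g² = 1` in `Gal(L/K)`.

* `exists_isPrimitiveRoot_borelField` — `∃ ζ ∈ K(χ₁,χ₂)`, a primitive `p`-th root of unity (`C ≠ 0, E[p]`; `E` elliptic, `char K = 0`).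
* `mul_self_mem_borelKernel_three` — `σ² ∈ borelKernel C` for every `σ ∈ Γ_K` (`p = 3`, `C` a stable line).
* `mul_self_eq_one_of_gal_borelField_three` — every element of `Gal(K(χ₁,χ₂)/K)` squares to `1` (`p = 3`).

References: [SilvermanAEC2009] Prop. III.8.1 (Weil pairing; tree `exists_weilPairing_holds`, PROVED); [Serre1972] §4 (Borel image,
`χ₁χ₂ = χ`); [Wuthrich2014] Lemma 14 (p. 396).  Design: no `instance`, no notation.  Axioms: `propext`, `Classical.choice`, `Quot.sound`.
-/

set_option autoImplicit false

noncomputable section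

open scoped Classical
open Field IntermediateField Literature.NumberTheory.EllipticCurves Literature.NumberTheory.GaloisRepresentations

universe u

namespace WeierstrassCurve

variable {K : Type u} [Field K] [CharZero K] (W : WeierstrassCurve K) {p : ℕ}

omit [CharZero K] in
/-- Restriction `Γ_K → Gal(E/K)` is onto for `E ⊆ K̄` normal over `K`. [folklore] -/
private theorem absRestrictNormalHom_surjective₃ (E : IntermediateField K (AlgebraicClosure K)) [Normal K E] :
    Function.Surjective (absRestrictNormalHom E) := fun g => by
  obtain ⟨σ, hσ⟩ := AlgEquiv.restrictNormalHom_surjective (AlgebraicClosure K) g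
  exact ⟨(Field.absoluteGaloisGroup.toAlgEquiv K).symm σ, hσ⟩

omit [CharZero K] in
/-- `((τ|_E) x : K̄) = τ • x`. [folklore] -/
private theorem coe_absRestrictNormalHom_apply₃ (E : IntermediateField K (AlgebraicClosure K)) [Normal K E]
    (τ : absoluteGaloisGroup K) (x : E) :
    ((absRestrictNormalHom E τ x : E) : AlgebraicClosure K) = τ • (x : AlgebraicClosure K) :=
  AlgEquiv.restrictNormalHom_apply E _ x

/-- **`μ_p ⊆ K(χ₁, χ₂)`: the Borel field of a line `C` (`C ≠ 0, E[p]`) contains a primitive `p`-th root of unity** — the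
value `e_p(g, y)` of the Weil pairing on a generator `g` of `C` and some `y ∉ C` is primitive and is fixed by the Borel kernel
(`σ·e_p(g,y) = e_p(σg, σy) = e_p(g, y + c) = e_p(g, y)`), i.e. `det ρ̄ = χ₁χ₂ = ω` is trivial on `ker χ₁ ∩ ker χ₂`.
[cite: SilvermanAEC2009, Prop. III.8.1 (a)–(d)] [cite: Serre1972, §4 (Borel image: χ₁χ₂ = det = χ)] -/
theorem exists_isPrimitiveRoot_borelField [W.IsElliptic] [hp : Fact p.Prime]
    (C : AddSubgroup (W.geomTorsion (p : ℤ))) (h1 : C ≠ ⊥) (h2 : C ≠ ⊤) :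
    ∃ ζ : ↥(W.borelField C), IsPrimitiveRoot ζ p := by
  have hpr : p.Prime := hp.out
  haveI : NeZero p := ⟨hpr.ne_zero⟩
  -- cardinalities and a generator `g ≠ 0` of `C`
  have hV : Nat.card (W.geomTorsion (p : ℤ)) = p ^ 2 := W.natCard_geomTorsion_eq_sq_of_charZero hpr
  haveI : Finite (W.geomTorsion (p : ℤ)) :=
    Nat.finite_of_card_ne_zero (by rw [hV]; exact pow_ne_zero 2 hpr.ne_zero)
  have hcard : Nat.card C = p := card_eq_of_ne_bot_of_ne_top hV h1 h2
  haveI : IsAddCyclic C := isAddCyclic_of_prime_card hcard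
  obtain ⟨g, hg⟩ := IsAddCyclic.exists_generator (α := C)
  -- the Weil pairing
  obtain ⟨e, hpow, haddl, haddr, hself, hnd, hgal⟩ :=
    W.exists_weilPairing_holds p hpr.two_le (Nat.cast_ne_zero.mpr hpr.ne_zero)
  have hne0 : ∀ S T, e S T ≠ 0 := fun S T h0 => by
    have := hpow S T
    rw [h0, zero_pow hpr.ne_zero] at this
    exact zero_ne_one this
  have hskew : ∀ S T, e S T * e T S = 1 := fun S T => by
    have h := hself (S + T)
    rw [haddl, haddr, haddr, hself S, hself T, one_mul, mul_one] at h
    exact h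
  set g₀ : W.geomTorsion (p : ℤ) := (g : W.geomTorsion (p : ℤ)) with hg₀def
  have hg0 : g₀ ≠ 0 := by
    intro h0
    have hg0' : g = 0 := Subtype.ext h0
    have hsub : ∀ x : C, x = 0 := fun x => by
      obtain ⟨k, hk⟩ := AddSubgroup.mem_zmultiples_iff.mp (hg x)
      rw [← hk, hg0', smul_zero]
    haveI : Subsingleton C := ⟨fun a b => by rw [hsub a, hsub b]⟩
    have h1' : Nat.card C ≤ 1 := Finite.card_le_one_iff_subsingleton.mpr inferInstance
    rw [hcard] at h1'
    exact absurd h1' (not_le.mpr hpr.one_lt)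
  -- some `y` with `e(g, y) ≠ 1` (left non-degeneracy via skew-symmetry)
  obtain ⟨y, hy⟩ : ∃ y : W.geomTorsion (p : ℤ), e g₀ y ≠ 1 := by
    by_contra hall
    push Not at hall
    apply hg0
    refine hnd g₀ fun S => ?_
    have h := hskew g₀ S
    rwa [hall S, one_mul] at h
  -- `ζ := e(g, y)` is a primitive `p`-th root of unity
  set ζ : AlgebraicClosure K := e g₀ y with hζdef
  have hζp : ζ ^ p = 1 := hpow g₀ y
  have hprim : IsPrimitiveRoot ζ p := by
    have hord : orderOf ζ = p := orderOf_eq_prime hζp hy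
    exact hord ▸ IsPrimitiveRoot.orderOf ζ
  -- `ζ` is fixed by the Borel kernel
  have hfix : ∀ σ : absoluteGaloisGroup K, σ ∈ W.borelKernel C → σ • ζ = ζ := by
    intro σ hσ
    obtain ⟨hσC, hσV⟩ := mem_borelKernel_iff.mp hσ
    have hσg : σ • g₀ = g₀ := hσC g₀ g.2
    -- `σ y = y + c` with `c ∈ C = ℤ g`, and `e(g, c) = 1`
    have hc : e g₀ (σ • y - y) = 1 := by
      obtain ⟨k, hk⟩ := AddSubgroup.mem_zmultiples_iff.mp (hg ⟨σ • y - y, hσV y⟩)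
      have hk' : σ • y - y = k • g₀ := by
        have := congrArg (fun z : C => (z : W.geomTorsion (p : ℤ))) hk
        simpa using this.symm
      rw [hk']
      -- `e(g, k • g) = e(g, g)^k = 1`
      have hzs : ∀ (m : ℤ), e g₀ (m • g₀) = 1 := by
        intro m
        induction m using Int.induction_on with
        | zero =>
          have h := haddr g₀ 0 0
          rw [add_zero] at h
          rw [zero_smul]
          exact (mul_right_eq_self₀.mp h.symm).resolve_right (hne0 g₀ 0)
        | succ n ih => rw [add_smul, one_smul, haddr, ih, hself, one_mul]
        | pred n ih =>
          have h := haddr g₀ ((-(n : ℤ) - 1) • g₀) g₀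
          rw [hself, mul_one, show (-(n : ℤ) - 1) • g₀ + g₀ = (-(n : ℤ)) • g₀ by rw [sub_smul, one_smul, sub_add_cancel],
            ih] at h
          exact h.symm
      exact hzs k
    have h3 : e g₀ (σ • y) = ζ := by
      have h4 : e g₀ (σ • y) = e g₀ (σ • y - y) * e g₀ y := by rw [← haddr, sub_add_cancel]
      rw [h4, hc, one_mul]
    rw [hζdef, hgal σ g₀ y, hσg]
    exact h3
  -- hence `ζ ∈ K(χ₁, χ₂)` (Galois correspondence for `K̄/K`)
  have hmem : ζ ∈ W.borelField C := by
    rw [borelField_def, IntermediateField.mem_fixedField_iff]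
    intro σ hσ
    exact hfix σ hσ
  refine ⟨⟨ζ, hmem⟩, ?_⟩
  exact hprim.of_map_of_injective (f := algebraMap (↥(W.borelField C)) (AlgebraicClosure K))
    (algebraMap (↥(W.borelField C)) (AlgebraicClosure K)).injective

/-- **At `p = 3`, `σ² ∈ borelKernel C` for every `σ ∈ Γ_K`** (`C` a `Γ_K`-stable line of `E[3]`, `E` elliptic, `char K = 0`):
`σ` acts on `C` and on `E[3]/C` by scalars in `𝔽₃^× = {±1}` (`exists_forall_smul_eq_zsmul_of_card_eq`,
`exists_forall_smul_sub_zsmul_mem`), whose squares are `1`. [cite: Serre1972, §4 (Borel image in GL₂(𝔽_p))] -/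
theorem mul_self_mem_borelKernel_three [W.IsElliptic] [Fact (3 : ℕ).Prime]
    {C : AddSubgroup (W.geomTorsion ((3 : ℕ) : ℤ))}
    (hC : ∀ (σ : absoluteGaloisGroup K) (x : W.geomTorsion ((3 : ℕ) : ℤ)), x ∈ C → σ • x ∈ C)
    (h1 : C ≠ ⊥) (h2 : C ≠ ⊤) (σ : absoluteGaloisGroup K) :
    σ * σ ∈ W.borelKernel C := by
  have h3 : (3 : ℕ).Prime := Fact.out
  have hV : Nat.card (W.geomTorsion ((3 : ℕ) : ℤ)) = 3 ^ 2 := W.natCard_geomTorsion_eq_sq_of_charZero h3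
  have hcard : Nat.card C = 3 := card_eq_of_ne_bot_of_ne_top hV h1 h2
  -- `3 • x = 0` on `E[3]`
  have h3x : ∀ x : W.geomTorsion ((3 : ℕ) : ℤ), (3 : ℤ) • x = 0 := fun x => by
    apply Subtype.ext
    have hx : ((x : W.geomTorsion ((3 : ℕ) : ℤ)) : geomPoints W) ∈ AddSubgroup.torsionBy (geomPoints W) ((3 : ℕ) : ℤ) := x.2
    rw [AddSubgroup.torsionBy, Submodule.mem_toAddSubgroup, Submodule.mem_torsionBy_iff] at hx
    rw [AddSubgroupClass.coe_zsmul, ZeroMemClass.coe_zero]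
    exact_mod_cast hx
  have hsz : ∀ (k : ℤ) (x : W.geomTorsion ((3 : ℕ) : ℤ)), σ • (k • x) = k • (σ • x) := fun k x =>
    map_zsmul (DistribSMul.toAddMonoidHom (↥(W.geomTorsion ((3 : ℕ) : ℤ))) σ) k x
  -- for `3 ∤ a`, `(a * a) • x = x`
  have hsq : ∀ (a : ℤ) (x : W.geomTorsion ((3 : ℕ) : ℤ)), ¬ (3 : ℤ) ∣ a → (a * a) • x = x := by
    intro a x ha
    have hm : a * a ≡ 1 [ZMOD 3] := by
      have : a % 3 = 1 ∨ a % 3 = 2 := by omega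
      rcases this with h | h
      · rw [Int.ModEq, Int.mul_emod, h]; norm_num
      · rw [Int.ModEq, Int.mul_emod, h]; norm_num
    obtain ⟨k, hk⟩ := Int.ModEq.dvd hm.symm
    have : a * a = 3 * k + 1 := by omega
    rw [this, add_smul, one_smul, mul_smul, h3x, zero_add]
  refine mem_borelKernel_iff.mpr ⟨fun x hx => ?_, fun y => ?_⟩
  · -- on `C`: `σ x = a x`, `3 ∤ a`
    obtain ⟨a, ha⟩ := exists_forall_smul_eq_zsmul_of_card_eq hC hcard σ
    have ha3 : ¬ (3 : ℤ) ∣ a := by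
      rintro ⟨m, rfl⟩
      -- then `σ` kills `C`, contradicting injectivity of `σ` and `C ≠ ⊥`
      apply h1
      rw [eq_bot_iff]
      intro c hc
      have hσc : σ • c = 0 := by rw [ha c hc, mul_smul, h3x]
      have : c = σ⁻¹ • (σ • c) := (inv_smul_smul σ c).symm
      rw [this, hσc, smul_zero]
      exact AddSubgroup.mem_bot.mpr rfl
    rw [mul_smul, ha x hx, hsz, ha x hx, smul_smul, hsq a x ha3]
  · -- on `E[3]/C`: `σ y - b y ∈ C`, `3 ∤ b`
    obtain ⟨b, hb⟩ := exists_forall_smul_sub_zsmul_mem hC hcard hV σ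
    have hb3 : ¬ (3 : ℤ) ∣ b := by
      rintro ⟨m, rfl⟩
      apply h2
      rw [eq_top_iff]
      intro y _
      have hσy : ∀ w : W.geomTorsion ((3 : ℕ) : ℤ), σ • w ∈ C := fun w => by
        have h := hb w
        rwa [mul_smul, h3x, sub_zero] at h
      have : y = σ • (σ⁻¹ • y) := (smul_inv_smul σ y).symm
      rw [this]
      exact hσy _
    -- `σ(σy) - y = σ(σy - by) + b(σy - by) + ((b*b) y - y)`
    have e1 : σ • (σ • y - b • y) ∈ C := hC σ _ (hb y)
    have e2 : b • (σ • y - b • y) ∈ C := C.zsmul_mem (hb y) b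
    have key : (σ * σ) • y - y = σ • (σ • y - b • y) + b • (σ • y - b • y) + ((b * b) • y - y) := by
      rw [mul_smul, smul_sub, hsz, smul_sub, smul_smul b b y]
      abel
    rw [key, hsq b y hb3, sub_self, add_zero]
    exact C.add_mem e1 e2

/-- **At `p = 3`, `Gal(K(χ₁, χ₂)/K)` is killed by `2`**: every element of the Galois group of the Borel field of a stable line of
`E[3]` squares to the identity (it is a restriction of some `σ ∈ Γ_K`, and `σ² ∈ borelKernel C = Gal(K̄/K(χ₁,χ₂))`).
[cite: Serre1972, §4 (Borel image in GL₂(𝔽₃))] [cite: Wuthrich2014, Lemma 14 (p. 396)] -/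
theorem mul_self_eq_one_of_gal_borelField_three [W.IsElliptic] [Fact (3 : ℕ).Prime]
    {C : AddSubgroup (W.geomTorsion ((3 : ℕ) : ℤ))}
    (hC : ∀ (σ : absoluteGaloisGroup K) (x : W.geomTorsion ((3 : ℕ) : ℤ)), x ∈ C → σ • x ∈ C)
    (h1 : C ≠ ⊥) (h2 : C ≠ ⊤) (g : ↥(W.borelField C) ≃ₐ[K] ↥(W.borelField C)) : g * g = 1 := by
  haveI : NeZero (3 : ℕ) := ⟨by decide⟩
  haveI : IsGalois K (W.borelField C) := isGalois_borelField hC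
  obtain ⟨σ, rfl⟩ := absRestrictNormalHom_surjective₃ (W.borelField C) g
  rw [← map_mul]
  have hσ : σ * σ ∈ ((W.borelField C).fixingSubgroup : Subgroup (absoluteGaloisGroup K)) := by
    rw [fixingSubgroup_borelField]
    exact W.mul_self_mem_borelKernel_three hC h1 h2 σ
  ext x
  rw [coe_absRestrictNormalHom_apply₃, AlgEquiv.one_apply]
  exact (IntermediateField.mem_fixingSubgroup_iff (W.borelField C) (σ * σ)).mp hσ x x.2

end WeierstrassCurve

end
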